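import Literature.AlgebraicGeometry.HodgeTheory.AbelianVarietySubvarietyIsotypicSupport
import HarnessLib

/-!
# Abelian subvarieties of a MULTIPLICITY-FREE abelian variety are the partial sums of its isotypic components:
# `Z = Σ_{q ∈ supp Z} Y_q` when every `Y_q` is simple; there are exactly `2^{#Q}` of them
# (Mumford §19 Cor. 1–2; Silverberg–Zarhin 2015 Def. 2.3; Lange–Rodríguez §2.9; Zarhin 2008 Thm. 3.2 = Lenstra–Oort–Zarhin)

Layer `Literature/AlgebraicGeometry/HodgeTheory`; theorems only (no `def`, no instance, no named fact; net debt 0).  §1 holds over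
ANY field in the setting of `HodgeTheory/AbelianVarietySubvarietyIsotypicPieces` §1 (a `Hom`-orthogonal system of abelian
subvarieties `i_q : Y_q ↪ X` whose addition map is an isogeny with quasi-inverse `v`, `desc i ≫ v = m • 𝟙`, `v ≫ desc i =
m • 𝟙`, `m ≠ 0`, central projectors `u_q = (v ≫ π_q) ≫ i_q`; an abelian subvariety `j : Z ↪ X` with its pieces
`a_q : Z_q = im(j ≫ u_q) ↪ Z`, `b_q : Z_q ↪ Y_q`) under the extra hypothesis that the members `Y_q` are SIMPLE
(`X` is «multiplicity-free»: `X ∼ ∏_q B_q` with the `B_q` pairwise non-isogenous simple); §2 works over a PERFECT field,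
where the pieces exist (Poincaré reducibility).

THE PRINT.  Mumford, *Abelian Varieties* §19 Cor. 1 of Thm. 1 (p. 173: `X ∼ ∏ X_i^{n_i}` with the `X_i` simple pairwise
non-isogenous) and Cor. 2 (p. 174: `End⁰(X) = ⊕ M_{n_i}(D_i)`; for `n_i = 1` a product of division algebras);
Silverberg–Zarhin 2015 Def. 2.2–2.3 (p. 3: the isotypic components are the maximal isotypic abelian subvarieties) and
proof of Lemma 3.3 (p. 5); Lange–Rodríguez 2022 §2.9 (PDF p. 44: the «isotypical abelian subvarieties» `Σ_j A^{e_{i_j}}`);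
Zarhin, *Homomorphisms of abelian varieties over finite fields* (2008) Thm. 3.2 (p. 7, = Lenstra–Oort–Zarhin, *Abelian
subvarieties*, J. Algebra 180 (1996)): «the set of abelian `K`-subvarieties of `X` is finite, up to the action of
`Aut(X)`».  In the multiplicity-free case the finiteness is absolute and elementary, which is what is proved here: the
`q`-th piece `Z_q ↪ Y_q` of an abelian subvariety `Z` is an abelian subvariety of the SIMPLE `Y_q`, hence `0` or all of
`Y_q`; so `Z ⊆ Σ_{q ∈ S} Y_q` for its support `S = {q : Z_q ≠ 0}` (the pieces outside `S` vanish) and `Y_q ⊆ Z` for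
`q ∈ S` (`i_q = b_q⁻¹ ≫ a_q ≫ j`), i.e. `Z = Σ_{q ∈ S} Y_q` as closed subsets of `X`; distinct `S` give distinct sums
(`Y_q ⊆ Σ_{T} Y_t ⟹ q ∈ T`, as `i_q ≫ u_q = m • i_q ≠ 0`), so the abelian subvarieties of `X` are in bijection with the
subsets of `Q`.

Results (namespace `Literature.AlgebraicGeometry.HodgeTheory.AbelianVariety`):
* §1 (any field) `comp_isotypicProjector_eq_zero_or_isIso_of_isSimple` (`Z_q = 0` or `b_q : Z_q ≅ Y_q`),
  `exists_comp_eq_component_of_isSimple` (`Z_q ≠ 0 ⟹ i_q` factors through `j`), `range_component_subset_range_of_isSimple`,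
  **`range_eq_range_biproduct_desc_of_isSimple`** (`range j = range (⨁_{q ∈ S} Y_q → X)` for `S = {q : j ≫ u_q ≠ 0}`),
  `exists_range_eq_range_biproduct_desc_of_isSimple` (given a quasi-retraction of `j`),
  `mem_of_range_component_subset_range_biproduct_desc` (`Y_q ⊆ Σ_T Y_t ⟹ q ∈ T`, `0 < dim Y_q`),
  **`injective_range_biproduct_desc_components`** (`T ↦ Σ_T Y_t` is injective on closed subsets);
* §2 (perfect field) **`exists_range_eq_range_biproduct_desc_of_isSimple_of_perfectField`** (every abelian subvariety of
  a multiplicity-free `X` is a partial sum of the components), `range_eq_range_biproduct_desc_support` (typed form: the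
  sum over the support `{q : Hom(B_q, Z) ≠ 0}`), **`setOf_range_eq_range_biproduct_desc`** (the closed subsets underlying
  abelian subvarieties of `X` are exactly the `2^{#Q}` partial sums), **`finite_setOf_range_subvariety`**,
  **`natCard_setOf_range_subvariety`** (`= 2 ^ #Q`).

## References
* [MumfordAV1970] D. Mumford, *Abelian Varieties* (1970), §19 Thm. 1, Cor. 1–2 (pp. 173–174).
* [SilverbergZarhin2015] A. Silverberg, Yu. G. Zarhin, *Isogenies of abelian varieties over finite fields*, Des. Codes
  Cryptogr. 77 (2015) (arXiv:1409.0592), Def. 2.2–2.3 (p. 3), Def. 3.2 and proof of Lemma 3.3 (p. 5).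
* [LangeRodriguez2022] H. Lange, R. E. Rodríguez, *Decomposition of Jacobians by Prym Varieties*, LNM 2310 (2022), §2.9
  Thm. 2.9.1 and the paragraph following it (PDF pp. 43–44).
* [Zarhin2008HomomorphismsFiniteFields] Yu. G. Zarhin, *Homomorphisms of abelian varieties over finite fields*, in:
  Higher-dimensional geometry over finite fields, IOS Press (2008) (arXiv:0711.1615), Thm. 3.2 and §5 (pp. 7, 9) —
  reporting H. W. Lenstra, F. Oort, Yu. G. Zarhin, *Abelian subvarieties*, J. Algebra 180 (1996) 513–516.
* [Milne1986AbelianVarieties] J. S. Milne, *Abelian Varieties*, in Cornell–Silverman (1986), §12 Prop. 12.1 (PDF p. 189).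
-/

noncomputable section

universe u

open CategoryTheory CategoryTheory.Limits

namespace Literature.AlgebraicGeometry.HodgeTheory

namespace AbelianVariety

open _root_.AlgebraicGeometry
open Literature.AlgebraicGeometry.Motives Literature.AlgebraicGeometry.Motives.AbelianVariety

variable {K : Type u} [Field K]

/-! ## §1 Simple components: every piece is `0` or the whole component (any field) -/

section AnyField

variable {Q : Type} [Fintype Q] {X Z : Motives.AbelianVariety K} {Y : Q → Motives.AbelianVariety K} (i : ∀ q, Y q ⟶ X)
  {v : X ⟶ ⨁ Y} {m : ℕ} (j : Z ⟶ X)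

/-- **`Z_q = 0` or `Z_q = Y_q`** when `Y_q` is simple: either `j ≫ u_q = 0` or the closed immersion `b_q : Z_q ↪ Y_q` is an
isomorphism (an abelian subvariety of positive dimension of a simple abelian variety is everything).
[cite: MumfordAV1970, §19 Cor. 1 of Thm. 1 (p. 173) and definition of simplicity p. 174] [cite: SilverbergZarhin2015, Def. 2.2–2.3 (p. 3)] -/
theorem comp_isotypicProjector_eq_zero_or_isIso_of_isSimple {q : Q} (hYq : (Y q).IsSimple)
    (b : image (j ≫ (v ≫ biproduct.π Y q) ≫ i q) ⟶ Y q) (hbci : IsClosedImmersion (Hom.toSchemeHom b)) :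
    j ≫ (v ≫ biproduct.π Y q) ≫ i q = 0 ∨ IsIso b := by
  by_cases h0 : j ≫ (v ≫ biproduct.π Y q) ≫ i q = 0
  · exact Or.inl h0
  · refine Or.inr ?_
    haveI := hbci
    have hpos : 0 < (image (j ≫ (v ≫ biproduct.π Y q) ≫ i q)).dim :=
      Nat.pos_of_ne_zero fun h ↦ h0 ((dim_image_eq_zero_iff _).1 h)
    exact isIso_of_isClosedImmersion_of_dim_eq b (hYq.dim_eq_of_isFinite b hpos)

/-- **A non-zero piece swallows the component**: if `Y_q` is simple and `j ≫ u_q ≠ 0`, then `i_q` factors through `j`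
(`i_q = b_q⁻¹ ≫ a_q ≫ j`), i.e. `Y_q ⊆ Z`. [cite: SilverbergZarhin2015, Def. 2.3 (p. 3: isotypic components are maximal)]
[cite: MumfordAV1970, §19 Cor. 1–2 of Thm. 1 (pp. 173–174)] -/
theorem exists_comp_eq_component_of_isSimple {q : Q} (hYq : (Y q).IsSimple) (hq : j ≫ (v ≫ biproduct.π Y q) ≫ i q ≠ 0)
    (a : image (j ≫ (v ≫ biproduct.π Y q) ≫ i q) ⟶ Z) (ha : a ≫ j = imageι (j ≫ (v ≫ biproduct.π Y q) ≫ i q))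
    (b : image (j ≫ (v ≫ biproduct.π Y q) ≫ i q) ⟶ Y q) (hb : b ≫ i q = imageι (j ≫ (v ≫ biproduct.π Y q) ≫ i q))
    (hbci : IsClosedImmersion (Hom.toSchemeHom b)) : ∃ g : Y q ⟶ Z, g ≫ j = i q := by
  haveI : IsIso b := (comp_isotypicProjector_eq_zero_or_isIso_of_isSimple i j hYq b hbci).resolve_left hq
  exact ⟨inv b ≫ a, by rw [Category.assoc, ha, ← hb, IsIso.inv_hom_id_assoc]⟩

/-- `Y_q ⊆ Z` as closed subsets of `X` when `Y_q` is simple and `Z_q ≠ 0`. [cite: SilverbergZarhin2015, Def. 2.3 (p. 3)]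
[cite: LangeRodriguez2022, §2.9 (PDF p. 44)] -/
theorem range_component_subset_range_of_isSimple {q : Q} (hYq : (Y q).IsSimple)
    (hq : j ≫ (v ≫ biproduct.π Y q) ≫ i q ≠ 0)
    (a : image (j ≫ (v ≫ biproduct.π Y q) ≫ i q) ⟶ Z) (ha : a ≫ j = imageι (j ≫ (v ≫ biproduct.π Y q) ≫ i q))
    (b : image (j ≫ (v ≫ biproduct.π Y q) ≫ i q) ⟶ Y q) (hb : b ≫ i q = imageι (j ≫ (v ≫ biproduct.π Y q) ≫ i q))
    (hbci : IsClosedImmersion (Hom.toSchemeHom b)) :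
    Set.range (Hom.toSchemeHom (i q)) ⊆ Set.range (Hom.toSchemeHom j) := by
  obtain ⟨g, hg⟩ := exists_comp_eq_component_of_isSimple i j hYq hq a ha b hb hbci
  rw [← hg]
  exact range_toSchemeHom_comp_subset g j

/-- **`Z = Σ_{q ∈ S} Y_q` FOR MULTIPLICITY-FREE `X`**: if every `Y_q` is simple, an abelian subvariety `j : Z ↪ X` (with
pieces `a_q`, `b_q`) and `S = {q : j ≫ u_q ≠ 0}` satisfy `range j = range (⨁_{q ∈ S} Y_q → X)` — `⊆` because the pieces
outside `S` vanish, `⊇` because `Y_q ⊆ Z` for `q ∈ S`. [cite: MumfordAV1970, §19 Cor. 1–2 of Thm. 1 (pp. 173–174)]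
[cite: SilverbergZarhin2015, Def. 2.3 (p. 3) and proof of Lemma 3.3 (p. 5)] [cite: LangeRodriguez2022, §2.9 (PDF p. 44)]
[cite: Zarhin2008HomomorphismsFiniteFields, Thm. 3.2 (p. 7)] -/
theorem range_eq_range_biproduct_desc_of_isSimple (hdv : biproduct.desc i ≫ v = m • 𝟙 (⨁ Y))
    (hvd : v ≫ biproduct.desc i = m • 𝟙 X) (hm : m ≠ 0) (hYs : ∀ q, (Y q).IsSimple)
    (a : ∀ q, image (j ≫ (v ≫ biproduct.π Y q) ≫ i q) ⟶ Z) (ha : ∀ q, a q ≫ j = imageι (j ≫ (v ≫ biproduct.π Y q) ≫ i q))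
    (b : ∀ q, image (j ≫ (v ≫ biproduct.π Y q) ≫ i q) ⟶ Y q)
    (hb : ∀ q, b q ≫ i q = imageι (j ≫ (v ≫ biproduct.π Y q) ≫ i q)) (hbci : ∀ q, IsClosedImmersion (Hom.toSchemeHom (b q)))
    (S : Finset Q) (hS : ∀ q, q ∈ S ↔ j ≫ (v ≫ biproduct.π Y q) ≫ i q ≠ 0) :
    Set.range (Hom.toSchemeHom j) = Set.range (Hom.toSchemeHom (biproduct.desc fun s : S ↦ i s)) := by
  classical
  refine Set.Subset.antisymm ((range_subset_range_desc_components_iff i j hdv hvd hm S).2 fun q hq ↦ ?_) ?_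
  · by_contra h0
    exact hq ((hS q).2 h0)
  · have hg : ∀ s : S, ∃ g : Y s ⟶ Z, g ≫ j = i s := fun s ↦
      exists_comp_eq_component_of_isSimple i j (hYs s) ((hS s).1 s.2) (a s) (ha s) (b s) (hb s) (hbci s)
    choose g hg using hg
    have hfac : biproduct.desc (fun s : S ↦ i s) = biproduct.desc g ≫ j :=
      biproduct.hom_ext' _ _ fun s ↦ by rw [biproduct.ι_desc, biproduct.ι_desc_assoc, hg]
    rw [hfac]
    exact range_toSchemeHom_comp_subset _ j

/-- Choice-free form: if every `Y_q` is simple and `j : Z ↪ X` has a quasi-retraction (`j ≫ h = N • 𝟙`, `N ≠ 0`), then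
`range j = range (⨁_{q ∈ S} Y_q → X)` for some `S`. [cite: MumfordAV1970, §19 Thm. 1 and Cor. 1–2 (pp. 173–174)]
[cite: SilverbergZarhin2015, Def. 2.3 (p. 3)] [cite: Zarhin2008HomomorphismsFiniteFields, Thm. 3.2 (p. 7)] -/
theorem exists_range_eq_range_biproduct_desc_of_isSimple (hi : ∀ q, IsClosedImmersion (Hom.toSchemeHom (i q)))
    (hdesc : IsIsogeny (biproduct.desc i)) (hdv : biproduct.desc i ≫ v = m • 𝟙 (⨁ Y))
    (hvd : v ≫ biproduct.desc i = m • 𝟙 X) (horth : ∀ q q', q ≠ q' → ∀ f : Y q ⟶ Y q', f = 0) (hm : m ≠ 0)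
    (hYs : ∀ q, (Y q).IsSimple) [IsClosedImmersion (Hom.toSchemeHom j)] {h : X ⟶ Z} {N : ℕ} (hN : N ≠ 0)
    (hjh : j ≫ h = N • 𝟙 Z) :
    ∃ S : Finset Q, Set.range (Hom.toSchemeHom j) = Set.range (Hom.toSchemeHom (biproduct.desc fun s : S ↦ i s)) := by
  classical
  obtain ⟨a, b, ha, -, hb, hbci⟩ := exists_isotypicPieces i j hi hdesc hdv horth hN hjh
  exact ⟨Finset.univ.filter fun q ↦ j ≫ (v ≫ biproduct.π Y q) ≫ i q ≠ 0,
    range_eq_range_biproduct_desc_of_isSimple i j hdv hvd hm hYs a ha b hb hbci _ fun q ↦ by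
      rw [Finset.mem_filter]
      exact ⟨fun h ↦ h.2, fun h ↦ ⟨Finset.mem_univ q, h⟩⟩⟩

/-- **`Y_q ⊆ Σ_{t ∈ T} Y_t ⟹ q ∈ T`** for components of positive dimension (`i_q ≫ u_q = m • i_q ≠ 0`, whereas
`Σ_T Y_t` is killed by `u_q`, `q ∉ T`). [cite: LangeRodriguez2022, §2.9 Thm. 2.9.1 (PDF p. 43)] [cite: MumfordAV1970, §19 Cor. 2 of Thm. 1 (p. 174)] -/
theorem mem_of_range_component_subset_range_biproduct_desc (hi : ∀ q, IsClosedImmersion (Hom.toSchemeHom (i q)))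
    (hdv : biproduct.desc i ≫ v = m • 𝟙 (⨁ Y)) (hvd : v ≫ biproduct.desc i = m • 𝟙 X) (hm : m ≠ 0)
    (hY0 : ∀ q, 0 < (Y q).dim) {q : Q} {T : Finset Q}
    (hT : Set.range (Hom.toSchemeHom (i q)) ⊆ Set.range (Hom.toSchemeHom (biproduct.desc fun t : T ↦ i t))) :
    q ∈ T := by
  by_contra hq
  have h0 := (range_subset_range_desc_components_iff i (i q) hdv hvd hm T).1 hT q hq
  rw [comp_isotypicProjector_self i hdv q] at h0
  haveI := hi q
  exact ne_zero_of_isFinite (i q) (hY0 q) (hom_eq_zero_of_nsmul_eq_zero hm h0)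

/-- **`T ↦ Σ_{t ∈ T} Y_t` is injective on closed subsets of `X`** (components of positive dimension).
[cite: LangeRodriguez2022, §2.9 (PDF p. 44)] [cite: MumfordAV1970, §19 Cor. 1–2 of Thm. 1 (pp. 173–174)] -/
theorem injective_range_biproduct_desc_components (hi : ∀ q, IsClosedImmersion (Hom.toSchemeHom (i q)))
    (hdv : biproduct.desc i ≫ v = m • 𝟙 (⨁ Y)) (hvd : v ≫ biproduct.desc i = m • 𝟙 X) (hm : m ≠ 0)
    (hY0 : ∀ q, 0 < (Y q).dim) :
    Function.Injective fun T : Finset Q ↦ Set.range (Hom.toSchemeHom (biproduct.desc fun t : T ↦ i t)) := by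
  classical
  have hsub : ∀ (T : Finset Q) (q : Q), q ∈ T →
      Set.range (Hom.toSchemeHom (i q)) ⊆ Set.range (Hom.toSchemeHom (biproduct.desc fun t : T ↦ i t)) :=
    fun T q hq ↦ by
      have hfac : i q = biproduct.ι (fun t : T ↦ Y t) ⟨q, hq⟩ ≫ biproduct.desc fun t : T ↦ i t := by
        rw [biproduct.ι_desc]
      rw [hfac]
      exact range_toSchemeHom_comp_subset _ _
  intro T T' hTT'
  dsimp only at hTT'
  ext q
  constructor
  · intro hq
    have h := hsub T q hq
    rw [hTT'] at h
    exact mem_of_range_component_subset_range_biproduct_desc i hi hdv hvd hm hY0 h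
  · intro hq
    have h := hsub T' q hq
    rw [← hTT'] at h
    exact mem_of_range_component_subset_range_biproduct_desc i hi hdv hvd hm hY0 h

end AnyField

/-! ## §2 Over a perfect field: the abelian subvarieties of a multiplicity-free `X` are the `2^{#Q}` partial sums -/

section Perfect

variable [PerfectField K] {Q : Type} [Fintype Q] {B : Q → Motives.AbelianVariety K} {X Z : Motives.AbelianVariety K}
  {Y : Q → Motives.AbelianVariety K}

/-- **EVERY ABELIAN SUBVARIETY OF A MULTIPLICITY-FREE ABELIAN VARIETY IS A PARTIAL SUM OF ITS ISOTYPIC COMPONENTS**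
(perfect field): for a `Hom`-orthogonal system of SIMPLE abelian subvarieties `i_q : Y_q ↪ X` whose addition map is an
isogeny and every abelian subvariety `j : Z ↪ X`, `range j = range (⨁_{q ∈ S} Y_q → X)` for some `S ⊆ Q`.
[cite: MumfordAV1970, §19 Thm. 1 and Cor. 1–2 (pp. 173–174)] [cite: SilverbergZarhin2015, Def. 2.3 (p. 3) and proof of Lemma 3.3 (p. 5)]
[cite: LangeRodriguez2022, §2.9 (PDF p. 44)] [cite: Zarhin2008HomomorphismsFiniteFields, Thm. 3.2 (p. 7)] -/
theorem exists_range_eq_range_biproduct_desc_of_isSimple_of_perfectField (i : ∀ q, Y q ⟶ X)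
    (hi : ∀ q, IsClosedImmersion (Hom.toSchemeHom (i q))) (hdesc : IsIsogeny (biproduct.desc i))
    (horth : ∀ q q', q ≠ q' → ∀ f : Y q ⟶ Y q', f = 0) (hYs : ∀ q, (Y q).IsSimple) (j : Z ⟶ X)
    [IsClosedImmersion (Hom.toSchemeHom j)] :
    ∃ S : Finset Q, Set.range (Hom.toSchemeHom j) = Set.range (Hom.toSchemeHom (biproduct.desc fun s : S ↦ i s)) := by
  obtain ⟨v, m, hm, hdv, hvd⟩ := IsIsogeny.exists_nsmul_inverse_holds hdesc
  obtain ⟨h, N, hN, hjh⟩ := exists_quasiRetraction_of_perfectField j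
  exact exists_range_eq_range_biproduct_desc_of_isSimple i j hi hdesc hdv hvd horth hm.ne' hYs hN hjh

/-- Typed form: for isotypic components `Y_q ∼ B_q` of MULTIPLICITY ONE (`B_q` simple of positive dimension, pairwise
non-isogenous, addition map an isogeny) and an abelian subvariety `j : Z ↪ X` with support `S = {q : Hom(B_q, Z) ≠ 0}`:
`range j = range (⨁_{q ∈ S} Y_q → X)`. [cite: MumfordAV1970, §19 Cor. 1–2 of Thm. 1 (pp. 173–174)]
[cite: SilverbergZarhin2015, Def. 2.3 (p. 3), Lemma 3.1 and proof of Lemma 3.3 (p. 5)] [cite: LangeRodriguez2022, §2.9 (PDF p. 44)] -/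
theorem range_eq_range_biproduct_desc_support (hB : ∀ q, (B q).IsSimple) (hB0 : ∀ q, 0 < (B q).dim)
    (hni : ∀ q q', q ≠ q' → ¬ IsIsogenous (B q) (B q')) (hY : ∀ q, IsIsogenous (Y q) (B q)) (i : ∀ q, Y q ⟶ X)
    (hi : ∀ q, IsClosedImmersion (Hom.toSchemeHom (i q))) (hdesc : IsIsogeny (biproduct.desc i)) (j : Z ⟶ X)
    [IsClosedImmersion (Hom.toSchemeHom j)] (S : Finset Q) (hS : ∀ q, q ∈ S ↔ ∃ f : B q ⟶ Z, f ≠ 0) :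
    Set.range (Hom.toSchemeHom j) = Set.range (Hom.toSchemeHom (biproduct.desc fun s : S ↦ i s)) := by
  have h1 : ∀ q, IsIsogenous (B q) (⨁ fun _ : Fin 1 ↦ B q) := fun q ↦
    ⟨(biproductUniqueIso (fun _ : Fin 1 ↦ B q)).inv, isIsogeny_hom_of_iso (biproductUniqueIso _).symm⟩
  have hY' : ∀ q, IsIsogenous (Y q) (⨁ fun _ : Fin (0 + 1) ↦ B q) := fun q ↦ (hY q).trans (h1 q)
  have horth : ∀ q q', q ≠ q' → ∀ f : Y q ⟶ Y q', f = 0 := fun q q' hqq' f ↦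
    hom_eq_zero_of_isIsogenous_biproduct_const_of_ne hB hB0 hni hqq' (hY' q) (hY' q') f
  have hYs : ∀ q, (Y q).IsSimple := fun q ↦ (hY q).isSimple_symm (hB q)
  obtain ⟨v, m, hm, hdv, hvd⟩ := IsIsogeny.exists_nsmul_inverse_holds hdesc
  obtain ⟨h, N, hN, hjh⟩ := exists_quasiRetraction_of_perfectField j
  obtain ⟨a, b, ha, -, hb, hbci⟩ := exists_isotypicPieces i j hi hdesc hdv horth hN hjh
  refine range_eq_range_biproduct_desc_of_isSimple i j hdv hvd hm.ne' hYs a ha b hb hbci S fun q ↦ ?_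
  rw [hS, Ne, comp_isotypicProjector_eq_zero_iff_forall_hom_simple_eq_zero (n := fun _ ↦ 0) hB hB0 hni hY' i hi hdesc
    hdv hm.ne' j q, not_forall]

/-- **THE CLOSED SUBSETS UNDERLYING THE ABELIAN SUBVARIETIES OF A MULTIPLICITY-FREE `X` ARE EXACTLY THE PARTIAL SUMS
`Σ_{q ∈ T} Y_q`, `T ⊆ Q`** (perfect field; simple `Hom`-orthogonal components). [cite: MumfordAV1970, §19 Thm. 1 and Cor. 1–2 (pp. 173–174)]
[cite: SilverbergZarhin2015, Def. 2.3 (p. 3)] [cite: Zarhin2008HomomorphismsFiniteFields, Thm. 3.2 (p. 7)] -/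
theorem setOf_range_eq_range_biproduct_desc (i : ∀ q, Y q ⟶ X) (hi : ∀ q, IsClosedImmersion (Hom.toSchemeHom (i q)))
    (hdesc : IsIsogeny (biproduct.desc i)) (horth : ∀ q q', q ≠ q' → ∀ f : Y q ⟶ Y q', f = 0)
    (hYs : ∀ q, (Y q).IsSimple) :
    {R : Set X.X.left | ∃ (Z : Motives.AbelianVariety K) (j : Z ⟶ X),
        IsClosedImmersion (Hom.toSchemeHom j) ∧ R = Set.range (Hom.toSchemeHom j)} =
      Set.range fun T : Finset Q ↦ Set.range (Hom.toSchemeHom (biproduct.desc fun t : T ↦ i t)) := by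
  ext R
  constructor
  · rintro ⟨Z, j, hj, rfl⟩
    haveI := hj
    obtain ⟨S, hS⟩ := exists_range_eq_range_biproduct_desc_of_isSimple_of_perfectField i hi hdesc horth hYs j
    exact ⟨S, hS.symm⟩
  · rintro ⟨T, rfl⟩
    exact ⟨_, imageι (biproduct.desc fun t : T ↦ i t), inferInstance, (range_toSchemeHom_imageι _).symm⟩

/-- **A multiplicity-free abelian variety has only finitely many abelian subvarieties** (as closed subsets; perfect
field). [cite: Zarhin2008HomomorphismsFiniteFields, Thm. 3.2 (p. 7) (Lenstra–Oort–Zarhin 1996)] [cite: MumfordAV1970, §19 Cor. 1–2 of Thm. 1 (pp. 173–174)] -/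
theorem finite_setOf_range_subvariety (i : ∀ q, Y q ⟶ X) (hi : ∀ q, IsClosedImmersion (Hom.toSchemeHom (i q)))
    (hdesc : IsIsogeny (biproduct.desc i)) (horth : ∀ q q', q ≠ q' → ∀ f : Y q ⟶ Y q', f = 0)
    (hYs : ∀ q, (Y q).IsSimple) :
    {R : Set X.X.left | ∃ (Z : Motives.AbelianVariety K) (j : Z ⟶ X),
        IsClosedImmersion (Hom.toSchemeHom j) ∧ R = Set.range (Hom.toSchemeHom j)}.Finite := by
  rw [setOf_range_eq_range_biproduct_desc i hi hdesc horth hYs]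
  exact Set.finite_range _

/-- **There are exactly `2^{#Q}` of them** when the components have positive dimension (perfect field): the partial sums
`Σ_T Y_t` are pairwise distinct. [cite: MumfordAV1970, §19 Cor. 1–2 of Thm. 1 (pp. 173–174)]
[cite: LangeRodriguez2022, §2.9 (PDF p. 44)] [cite: Zarhin2008HomomorphismsFiniteFields, Thm. 3.2 (p. 7)] -/
theorem natCard_setOf_range_subvariety (i : ∀ q, Y q ⟶ X) (hi : ∀ q, IsClosedImmersion (Hom.toSchemeHom (i q)))
    (hdesc : IsIsogeny (biproduct.desc i)) (horth : ∀ q q', q ≠ q' → ∀ f : Y q ⟶ Y q', f = 0)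
    (hYs : ∀ q, (Y q).IsSimple) (hY0 : ∀ q, 0 < (Y q).dim) :
    Nat.card {R : Set X.X.left | ∃ (Z : Motives.AbelianVariety K) (j : Z ⟶ X),
        IsClosedImmersion (Hom.toSchemeHom j) ∧ R = Set.range (Hom.toSchemeHom j)} = 2 ^ Fintype.card Q := by
  classical
  obtain ⟨v, m, hm, hdv, hvd⟩ := IsIsogeny.exists_nsmul_inverse_holds hdesc
  rw [setOf_range_eq_range_biproduct_desc i hi hdesc horth hYs,
    Nat.card_range_of_injective (injective_range_biproduct_desc_components i hi hdv hvd hm.ne' hY0),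
    Nat.card_eq_fintype_card, Fintype.card_finset]

end Perfect

end AbelianVariety

end Literature.AlgebraicGeometry.HodgeTheory

end
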